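import Mathlib
import HarnessLib
import Literature.Analysis.FluidPDE.BarkerPrange2020VorticityAlignmentTypeIHolds
import Summits.NavierStokesRegularity.NavierStokesRegularity.Theorems.PoloidalWindowDoorPoloidalWindowRigidityWindow
import Summits.NavierStokesRegularity.NavierStokesRegularity.Theorems.PoloidalWindowDoorPoloidalWindowRigidityHotForestCapturedCore

/-!
# Route `PoloidalWindowDoor`, crux `PoloidalWindowRigidity` (stmt-NavierStokesRegularity-19708) — LINE 20 «hot_forest» v1.2
# (ns-idea-8 g10; critics idea-crit-8 g5 / idea-crit-7 g7 PASS-WITH-PRICE; director-ns KEY-NS #198 (3)): support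
# F3 `stub_capturedEndConverges_of_branches : PlanarZeroBranches → CapturedEndConverges`, VERBATIM
# (Cruxes-local `PlanarZeroBranches` / `CapturedEndConverges` / `Pinned` / `hotSet` unfolded)

Seat ns-es-p1 g7 (free prover hand; CLAIM announced on the ideators / ns-regularity-ideate buses before proposing).

* `capturedEndConverges_of_branches` (F3 ⇐ V1): GIVEN the branch structure V1 of planar real-analytic zero sets (a hypothesis —
  the line vendors it as a Literature fact), an injective global hot vortex line `γ` of a pinned profile (hot set without planar
  interior) that has a zero `q` of `ω(−1,·)` as a cluster value at `+∞` (resp. `−∞`) CONVERGES to `q` at that end.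

PROOF: `q` is hot (the hot set is closed and contains the cluster value of a curve running in it); V1 applied to the analytic
function `g := v₂(−1,·) − N` (`IsTypeIAncientMild.analyticOnNhd_slice_univ`) at `q` gives distance-parametrised disjoint
half-branches covering the punctured zero set near `q`; `γ` avoids `q` (`ω(γ τ) ≠ 0 = ω(q)`); the topological core
`…HotForestCapturedCore.captured_core` concludes at `+∞`, and at `−∞` after the time reversal `γ ∘ Neg.neg`
(`Filter.map_neg_atTop`).  The derivative hypothesis is used only for continuity.

HONEST LABEL: ONE support stub (M) of a registered line, conditional on V1 exactly as registered; it closes no cell, no crux and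
no route item; ESC-END / CONVERGENT-WEB, C2a′ / C2b′ / S0, 19708 / 20428 and NS regularity stay OPEN — no summit statement is
proved here.
-/

noncomputable section

-- the summit and its single sub-problem share the name (CONVENTIONS §1), as in every Theorems file
set_option linter.dupNamespace false

namespace Summit.NavierStokesRegularity.NavierStokesRegularity.Theorems.PoloidalWindowDoorPoloidalWindowRigidityHotForestCapturedEnd

open Set Function Filter Topology Metric
open scoped InnerProductSpace RealInnerProductSpace Laplacian NNReal
open Literature.Analysis Literature.Analysis.FluidPDE
open Summit.NavierStokesRegularity.NavierStokesRegularity.Theorems.PoloidalWindowDoorPoloidalWindowRigidityWindow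
open Summit.NavierStokesRegularity.NavierStokesRegularity.Theorems.PoloidalWindowDoorPoloidalWindowRigidityHotForestCapturedCore

/-! ## F3 ⇐ V1 -/

/-- **F3 `CapturedEndConverges` from V1 `PlanarZeroBranches` (VERBATIM, line-local defs unfolded).**  See the module docstring. -/
theorem capturedEndConverges_of_branches :
    (∀ (g : EuclideanSpace ℝ (Fin 3) → ℝ), AnalyticOnNhd ℝ g Set.univ →
      ∀ q : EuclideanSpace ℝ (Fin 3), q 2 = 0 → g q = 0 →
        (∀ r : ℝ, 0 < r → ∃ y : EuclideanSpace ℝ (Fin 3), y 2 = 0 ∧ dist y q < r ∧ g y ≠ 0) →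
        ∃ r : ℝ, 0 < r ∧ ∃ (m : ℕ) (β : Fin m → ℝ → EuclideanSpace ℝ (Fin 3)),
          (∀ i, ContinuousOn (β i) (Set.Ico 0 1) ∧ β i 0 = q ∧
            ∀ s ∈ Set.Ico (0 : ℝ) 1, (β i s) 2 = 0 ∧ g (β i s) = 0 ∧ dist (β i s) q = r * s) ∧
          (∀ i j, ∀ s ∈ Set.Ioo (0 : ℝ) 1, β i s = β j s → i = j) ∧
          (∀ y : EuclideanSpace ℝ (Fin 3), y 2 = 0 → g y = 0 → 0 < dist y q → dist y q < r →
            ∃ i, ∃ s ∈ Set.Ioo (0 : ℝ) 1, y = β i s)) →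
    ∀ (C : ℝ) (v : ℝ → EuclideanSpace ℝ (Fin 3) → EuclideanSpace ℝ (Fin 3)),
      (Literature.Analysis.FluidPDE.HasTypeITimeDecay C v ∧
        ContinuousOn (Function.uncurry v) (Set.Iio (0 : ℝ) ×ˢ Set.univ) ∧
        (∀ s t : ℝ, s < t → t < 0 → ∀ x, v t x =
          Literature.Analysis.UnboundedOperators.heatExtension (v s) (t - s) x -
            Literature.Analysis.FluidPDE.oseenDuhamel 1 s v v t x) ∧
        (∀ t < 0, Literature.Analysis.FluidPDE.VectorCalculus.IsDivFree (v t)) ∧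
        (∀ s < 0, ∀ y, ⟪Literature.Analysis.FluidPDE.curl (v s) y, EuclideanSpace.single 2 1⟫_ℝ = 0) ∧
        v (-1) 0 2 ≠ 0 ∧ (∀ t < 0, ∀ x, Real.sqrt (-t) * |v t x 2| ≤ |v (-1) 0 2|) ∧
        (∀ h : EuclideanSpace ℝ (Fin 3), fderiv ℝ (v (-1)) 0 h 2 = 0) ∧
        (deriv (fun s => v s 0 2) (-1) = v (-1) 0 2 / 2 ∧ v (-1) 0 2 * (Δ (fun y => v (-1) y 2)) 0 ≤ 0)) →
      (∀ y ∈ {y : EuclideanSpace ℝ (Fin 3) | y 2 = 0 ∧ v (-1) y 2 = v (-1) 0 2}, ∀ r : ℝ, 0 < r →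
        ∃ y' : EuclideanSpace ℝ (Fin 3), y' 2 = 0 ∧ dist y' y < r ∧ v (-1) y' 2 ≠ v (-1) 0 2) →
      ∀ γ : ℝ → EuclideanSpace ℝ (Fin 3),
        (∀ τ : ℝ, HasDerivAt γ (Literature.Analysis.FluidPDE.curl (v (-1)) (γ τ)) τ) →
        (∀ τ : ℝ, γ τ ∈ {y : EuclideanSpace ℝ (Fin 3) | y 2 = 0 ∧ v (-1) y 2 = v (-1) 0 2} ∧
          Literature.Analysis.FluidPDE.curl (v (-1)) (γ τ) ≠ 0) → Function.Injective γ →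
        ∀ q : EuclideanSpace ℝ (Fin 3), Literature.Analysis.FluidPDE.curl (v (-1)) q = 0 →
          (MapClusterPt q Filter.atTop γ → Filter.Tendsto γ Filter.atTop (nhds q)) ∧
          (MapClusterPt q Filter.atBot γ → Filter.Tendsto γ Filter.atBot (nhds q)) := by
  intro hV1 C v hP hNoInt γ hγ hhot hinj q hq
  obtain ⟨hTI, hcont, hmild, hdiv, -, -, -, -, -⟩ := hP
  -- the class: continuous and analytic slice
  have hclass : IsTypeIAncientMild C v := isTypeIAncientMild_of_class hTI hcont hmild hdiv
  have hvc : Continuous (v (-1)) := hclass.continuous_slice (by norm_num)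
  have hwc : Continuous fun x : EuclideanSpace ℝ (Fin 3) => v (-1) x 2 :=
    (EuclideanSpace.proj (2 : Fin 3) : EuclideanSpace ℝ (Fin 3) →L[ℝ] ℝ).continuous.comp hvc
  have hgan : AnalyticOnNhd ℝ (fun x : EuclideanSpace ℝ (Fin 3) => v (-1) x 2 - v (-1) 0 2) Set.univ := fun x _ =>
    (((EuclideanSpace.proj (2 : Fin 3) : EuclideanSpace ℝ (Fin 3) →L[ℝ] ℝ).analyticAt _).comp
      (hclass.analyticOnNhd_slice_univ (by norm_num) x (mem_univ _))).sub analyticAt_const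
  -- the hot set is closed
  have hHcl : IsClosed {y : EuclideanSpace ℝ (Fin 3) | y 2 = 0 ∧ v (-1) y 2 = v (-1) 0 2} :=
    (isClosed_eq (EuclideanSpace.proj (2 : Fin 3) : EuclideanSpace ℝ (Fin 3) →L[ℝ] ℝ).continuous continuous_const).inter
      (isClosed_eq hwc continuous_const)
  -- the `+∞` statement for any continuous injective curve in the hot set avoiding the zeros of `ω`
  have key : ∀ γ' : ℝ → EuclideanSpace ℝ (Fin 3), Continuous γ' → Function.Injective γ' →
      (∀ τ : ℝ, γ' τ ∈ {y : EuclideanSpace ℝ (Fin 3) | y 2 = 0 ∧ v (-1) y 2 = v (-1) 0 2} ∧ curl (v (-1)) (γ' τ) ≠ 0) →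
      MapClusterPt q atTop γ' → Tendsto γ' atTop (𝓝 q) := by
    intro γ' hγ'c hγ'i hγ'hot hclus
    -- `q` is hot
    have hqH : q ∈ {y : EuclideanSpace ℝ (Fin 3) | y 2 = 0 ∧ v (-1) y 2 = v (-1) 0 2} := by
      by_contra hqH
      have hfr := (mapClusterPt_iff_frequently.1 hclus) _ (hHcl.isOpen_compl.mem_nhds hqH)
      obtain ⟨τ, hτ⟩ := hfr.exists
      exact hτ (hγ'hot τ).1
    obtain ⟨hq2, hqN⟩ := hqH
    -- V1 at `q` for `g = v₂(−1,·) − N`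
    obtain ⟨r, hr, m, β, hβ, hβinj, hβcov⟩ := hV1 _ hgan q hq2 (by simp only [hqN, sub_self])
      (fun r hr => by
        obtain ⟨y, hy2, hyd, hyN⟩ := hNoInt q ⟨hq2, hqN⟩ r hr
        exact ⟨y, hy2, hyd, sub_ne_zero.2 hyN⟩)
    refine captured_core hγ'c hγ'i (fun τ h => (hγ'hot τ).2 (by rw [h]; exact hq)) hr
      (fun i => (hβ i).1) (fun i s hs => ((hβ i).2.2 s hs).2.2) hβinj (fun τ hτ => ?_) hclus
    obtain ⟨⟨h2, hN⟩, hne⟩ := hγ'hot τ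
    have hpos : 0 < dist (γ' τ) q := dist_pos.2 fun h => hne (by rw [h]; exact hq)
    exact hβcov (γ' τ) h2 (by simp only [hN, sub_self]) hpos hτ
  refine ⟨key γ (continuous_iff_continuousAt.2 fun τ => (hγ τ).continuousAt) hinj hhot, fun hbot => ?_⟩
  -- the `−∞` statement by time reversal
  have hc' : Continuous (γ ∘ Neg.neg) :=
    (continuous_iff_continuousAt.2 fun τ => (hγ τ).continuousAt).comp continuous_neg
  have hi' : Function.Injective (γ ∘ Neg.neg) := hinj.comp neg_injective
  have hclus' : MapClusterPt q atTop (γ ∘ Neg.neg) := by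
    rw [mapClusterPt_def, ← Filter.map_map, Filter.map_neg_atTop]
    exact hbot
  have h := key (γ ∘ Neg.neg) hc' hi' (fun τ => hhot (-τ)) hclus'
  rw [← Filter.map_neg_atTop, Filter.tendsto_map'_iff]
  exact h

end Summit.NavierStokesRegularity.NavierStokesRegularity.Theorems.PoloidalWindowDoorPoloidalWindowRigidityHotForestCapturedEnd

end
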